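import Mathlib
import Summits.ResolutionOfSingularities.ResolutionOfSingularities.Theorems.RadicialJungCleanModelsDeficiencyFinite
import Literature.AlgebraicGeometry.Resolution.QuasiExcellentLocalization
import HarnessLib

/-!
# Route `RadicialJung`, crux `CleanModels` (stmt-ResolutionOfSingularities-15917), line `Sketch` rev 35, stub 6 `stub_cleanProp44` (X44c),
# work plan O8 / L7b-global, residual (b) in the currency of ✓ `exists_rep_not_mem_forall_cleanPermissibleAt_or_deficient_of_generic_unit`

Memo `Cruxes/CleanModels/Lines/Sketch-memo-hand2-g9-stubs-5-7.md` §3b.  The type-(2) spreading theorem ✓ p816913 reads the deficiency of the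
cleared unit representative `v ∈ A` (`A` the affine coordinate ring of the stage, `𝔭` the prime of the curve) at a prime `𝔮 ⊇ 𝔭` in the
local ring `R = A_𝔮`: `∃ c : R, v − c^p ∈ 𝔭R + 𝔪_R²`.  This file (i) contracts that condition to `A`: `∃ s ∉ 𝔮, e, s^p v − e^p ∈ 𝔭 + 𝔮²`
(`exists_deficient_of_localization`), and (ii) proves that the primes `𝔮 ⊇ 𝔭` where it holds are FINITELY MANY as soon as `A/𝔭` is a
one-dimensional J-2 domain (e.g. `A` quasi-excellent and the curve one-dimensional) and `v` is not a `p`-th power modulo `𝔭`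
(`finite_setOf_deficient_over`) — by passing to `D = A/𝔭` and ✓ `finite_setOf_deficient` (`…DeficiencyFinite.lean`).

Honest framing: OURS (bookkeeping around the deficiency-finiteness theorem); nothing here proves X44c or any case of `CleanModels`.
-/

noncomputable section

set_option linter.dupNamespace false -- mandated namespace of this single-conjunct summit

open IsLocalRing Literature.AlgebraicGeometry.Resolution

namespace Summit.ResolutionOfSingularities.ResolutionOfSingularities.Theorems.RadicialJung.CleanModels

universe u

/-- **Contracting the deficiency condition from `A_𝔮` to `A`.**  If `v − c^p ∈ 𝔭A_𝔮 + 𝔪²` for some `c ∈ A_𝔮`, then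
`s^p v − e^p ∈ 𝔭 + 𝔮²` for some `s ∉ 𝔮` and `e ∈ A` (write `c = e₀/s₀`, clear denominators, absorb the localising unit into `s`). -/
theorem exists_deficient_of_localization {A : Type u} [CommRing A] (p : ℕ) (hp : p ≠ 0) (𝔭 𝔮 : Ideal A) [𝔮.IsPrime]
    (R : Type u) [CommRing R] [IsLocalRing R] [Algebra A R] [IsLocalization.AtPrime R 𝔮] (v : A) (c : R)
    (hc : algebraMap A R v - c ^ p ∈ Ideal.map (algebraMap A R) 𝔭 ⊔ maximalIdeal R ^ 2) :
    ∃ s e : A, s ∉ 𝔮 ∧ s ^ p * v - e ^ p ∈ 𝔭 ⊔ 𝔮 ^ 2 := by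
  obtain ⟨e₀, s₀, hc₀⟩ := IsLocalization.exists_mk'_eq 𝔮.primeCompl c
  have hs₀ : (s₀ : A) ∉ 𝔮 := s₀.2
  -- the condition lives in the extension of `I := 𝔭 ⊔ 𝔮²`
  set I : Ideal A := 𝔭 ⊔ 𝔮 ^ 2 with hI
  have hmem : algebraMap A R (s₀ ^ p * v - e₀ ^ p) ∈ I.map (algebraMap A R) := by
    have h1 : Ideal.map (algebraMap A R) 𝔭 ⊔ maximalIdeal R ^ 2 = I.map (algebraMap A R) := by
      rw [hI, Ideal.map_sup, Ideal.map_pow, IsLocalization.AtPrime.map_eq_maximalIdeal 𝔮 R]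
    have h2 : algebraMap A R (s₀ ^ p * v - e₀ ^ p) = algebraMap A R s₀ ^ p * (algebraMap A R v - c ^ p) := by
      rw [← hc₀, mul_sub, ← mul_pow, IsLocalization.mk'_spec' R e₀ s₀, map_sub, map_mul, map_pow, map_pow]
    rw [h2, ← h1]
    exact Ideal.mul_mem_left _ _ hc
  obtain ⟨⟨⟨x, hx⟩, ⟨t, ht⟩⟩, hxt⟩ := (IsLocalization.mem_map_algebraMap_iff 𝔮.primeCompl R).mp hmem
  simp only at hxt
  have h3 : algebraMap A R ((s₀ ^ p * v - e₀ ^ p) * t - x) = 0 := by rw [map_sub, map_mul, hxt, sub_self]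
  obtain ⟨⟨u, hu⟩, hu0⟩ := (IsLocalization.map_eq_zero_iff 𝔮.primeCompl R _).mp h3
  simp only at hu0
  -- `w := u t ∉ 𝔮` with `w (s₀^p v − e₀^p) = u x ∈ I`
  have hut : u * t ∉ 𝔮 := fun h => ((inferInstance : 𝔮.IsPrime).mem_or_mem h).elim hu ht
  have hwI : u * t * (s₀ ^ p * v - e₀ ^ p) ∈ I := by
    have : u * t * (s₀ ^ p * v - e₀ ^ p) = u * ((s₀ ^ p * v - e₀ ^ p) * t - x) + u * x := by ring
    rw [this, hu0, zero_add]
    exact I.mul_mem_left u hx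
  refine ⟨u * t * s₀, u * t * e₀, fun h => ((inferInstance : 𝔮.IsPrime).mem_or_mem h).elim hut hs₀, ?_⟩
  have hp1 : p = (p - 1) + 1 := (Nat.sub_add_cancel (Nat.one_le_iff_ne_zero.mpr hp)).symm
  have : (u * t * s₀) ^ p * v - (u * t * e₀) ^ p = (u * t) ^ (p - 1) * (u * t * (s₀ ^ p * v - e₀ ^ p)) := by
    conv_lhs => rw [hp1]
    conv_rhs => rw [hp1]
    rw [Nat.add_sub_cancel]
    ring
  rw [this]
  exact I.mul_mem_left _ hwI

/-- **Finiteness of the deficiency set along a curve.**  `A` a domain of characteristic `p`, `𝔭` a prime with `A/𝔭` a one-dimensional J-2 domain,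
`v ∈ A` not a `p`-th power modulo `𝔭` (`s ∉ 𝔭 ⟹ s^p v − c^p ∉ 𝔭`).  Then the primes `𝔮 ⊇ 𝔭` at which `v` is deficient
(`∃ s ∉ 𝔮, e, s^p v − e^p ∈ 𝔭 + 𝔮²`) are finitely many. [cite: Matsumura1987, §32 p. 260 Definition] [cite: StacksProject, Tag 07P7] -/
theorem finite_setOf_deficient_over (p : ℕ) [hp : Fact p.Prime] {A : Type u} [CommRing A] [IsDomain A] [CharP A p] (𝔭 : Ideal A)
    [h𝔭 : 𝔭.IsPrime] (hJ : IsJ2Ring (A ⧸ 𝔭)) [Ring.DimensionLEOne (A ⧸ 𝔭)] (v : A) (hv : ∀ c s : A, s ∉ 𝔭 → s ^ p * v - c ^ p ∉ 𝔭) :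
    {𝔮 : Ideal A | 𝔮.IsPrime ∧ 𝔭 ≤ 𝔮 ∧ ∃ s e : A, s ∉ 𝔮 ∧ s ^ p * v - e ^ p ∈ 𝔭 ⊔ 𝔮 ^ 2}.Finite := by
  classical
  set mk : A →+* A ⧸ 𝔭 := Ideal.Quotient.mk 𝔭 with hmk
  haveI : Nontrivial (A ⧸ 𝔭) := Ideal.Quotient.nontrivial_iff.mpr h𝔭.ne_top
  haveI : CharP (A ⧸ 𝔭) p := CharP.of_ringHom_of_ne_zero mk p hp.out.ne_zero
  have hv' : ∀ c s : A ⧸ 𝔭, s ≠ 0 → s ^ p * mk v ≠ c ^ p := by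
    intro c s hs h
    obtain ⟨c, rfl⟩ := Ideal.Quotient.mk_surjective c
    obtain ⟨s, rfl⟩ := Ideal.Quotient.mk_surjective s
    have hs' : s ∉ 𝔭 := fun h' => hs (Ideal.Quotient.eq_zero_iff_mem.mpr h')
    refine hv c s hs' ?_
    rw [← Ideal.Quotient.eq_zero_iff_mem, map_sub, map_mul, map_pow, map_pow]
    exact sub_eq_zero.mpr h
  have hfin := finite_setOf_deficient p hJ (mk v) hv'
  -- `𝔮 ↦ 𝔮/𝔭` is injective on the primes containing `𝔭` and lands in the deficiency set of `v̄`
  refine Set.Finite.of_finite_image (f := fun 𝔮 : Ideal A => 𝔮.map mk) (hfin.subset ?_) ?_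
  · rintro _ ⟨𝔮, ⟨h𝔮p, h𝔭𝔮, s, e, hs, hse⟩, rfl⟩
    haveI := h𝔮p
    have hker : RingHom.ker mk ≤ 𝔮 := by rw [hmk, Ideal.mk_ker]; exact h𝔭𝔮
    refine ⟨Ideal.map_isPrime_of_surjective Ideal.Quotient.mk_surjective hker, mk s, mk e, fun h => hs ?_, ?_⟩
    · have : s ∈ (𝔮.map mk).comap mk := h
      rwa [Ideal.comap_map_of_surjective _ Ideal.Quotient.mk_surjective, ← RingHom.ker_eq_comap_bot, sup_eq_left.mpr hker] at this
    · have h1 : mk (s ^ p * v - e ^ p) ∈ (𝔭 ⊔ 𝔮 ^ 2).map mk := Ideal.mem_map_of_mem _ hse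
      rw [Ideal.map_sup, Ideal.map_pow, hmk, Ideal.map_quotient_self, bot_sup_eq] at h1
      simpa only [map_sub, map_mul, map_pow] using h1
  · rintro 𝔮₁ ⟨-, h₁, -⟩ 𝔮₂ ⟨-, h₂, -⟩ h
    have e₁ : (𝔮₁.map mk).comap mk = 𝔮₁ := by
      rw [Ideal.comap_map_of_surjective _ Ideal.Quotient.mk_surjective, ← RingHom.ker_eq_comap_bot, Ideal.mk_ker, sup_eq_left.mpr h₁]
    have e₂ : (𝔮₂.map mk).comap mk = 𝔮₂ := by
      rw [Ideal.comap_map_of_surjective _ Ideal.Quotient.mk_surjective, ← RingHom.ker_eq_comap_bot, Ideal.mk_ker, sup_eq_left.mpr h₂]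
    have : (𝔮₁.map mk).comap mk = (𝔮₂.map mk).comap mk := by simp only [h]
    rwa [e₁, e₂] at this

/-- The same with `A` **quasi-excellent** (J-2 passes to the quotient `A/𝔭`). [cite: Matsumura1987, §32 p. 260 Definition] -/
theorem finite_setOf_deficient_over_of_isQuasiExcellentRing (p : ℕ) [Fact p.Prime] {A : Type u} [CommRing A] [IsDomain A] [CharP A p]
    (hA : IsQuasiExcellentRing A) (𝔭 : Ideal A) [𝔭.IsPrime] [Ring.DimensionLEOne (A ⧸ 𝔭)] (v : A)
    (hv : ∀ c s : A, s ∉ 𝔭 → s ^ p * v - c ^ p ∉ 𝔭) :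
    {𝔮 : Ideal A | 𝔮.IsPrime ∧ 𝔭 ≤ 𝔮 ∧ ∃ s e : A, s ∉ 𝔮 ∧ s ^ p * v - e ^ p ∈ 𝔭 ⊔ 𝔮 ^ 2}.Finite :=
  finite_setOf_deficient_over p 𝔭 (IsJ2Ring.of_finiteType hA.2 inferInstance) v hv

end Summit.ResolutionOfSingularities.ResolutionOfSingularities.Theorems.RadicialJung.CleanModels

end
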